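import Mathlib
import HarnessLib

/-!
# Pure degree `d` on `d`-tuples and the Kneser-type bound (Keevash–Lifshitz 2023, §1.3 Lemma 1.3 and §2.7)

Source: P. Keevash, N. Lifshitz, *Sharp hypercontractivity for symmetric groups and its applications*,
arXiv:2307.15030 [KeevashLifshitz2023], §1.2 "Juntas", §1.3 "The spectrum of the Kneser graph"
(Lemma 1.3), §2.5–§2.7 (the staying decomposition, Lemmas 2.13–2.16); held text
`paper:arxiv-2307.15030` pp. 9–16 read first-hand (cell pnp-psdrank, lit g20, 2026-08-27).

This is the first brick of the tree's programme (cell pnp-psdrank memo LIT-26, "Milestone M") to PROVE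
the `S_n` layer of Keevash–Lifshitz Theorem 3.1 ⇒ Theorem 1.8 (the tree's named facts
`GlobalLevelDInequalityBiglobal`, `GlobalLevelDInequality` in `Literature/Combinatorics/Additive/`) on top
of the product-space level-`d` inequality of Keller–Lifshitz–Marcus. It contains the analysis on the
space `L²([n]_d)` of `d`-TUPLES OF DISTINCT ELEMENTS (here `Fin d ↪ α` for a finite type `α`) that the
printed proof of the junta lower bound (Lemma 2.9 ⇐ Lemma 2.11 ⇐ Lemmas 2.13–2.16 + Lemma 1.3) needs:

* `line i a` — the tuples agreeing with `a` off the coordinate `i`; `IsPureTop g` — ALL LINE SUMS OF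
  `g` VANISH. This is the paper's `V_{=d}(L²([n]_d))` ("orthogonal to all `(d−1)`-juntas", §1.2 and the
  proof of Lemma 2.16): `isPureTop_iff_orthogonal_juntas` proves the equivalence with orthogonality to
  every function not depending on some coordinate.
* `pat a b : Fin d → Option (Fin d)` — the PATTERN of `b` relative to `a` (coordinate `i` of `b` is the
  `j`-th value of `a`, or a value outside the range of `a`); `cls a π` — the pattern class. The classes
  partition the tuples (`sum_cls_sum`); the class of the identity pattern is `{a}`. (The paper's
  "staying" sets `stay(a,b)` of Def. 2.12 are the coordinates with `pat a b i ≠ none`; the pattern is the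
  finer invariant that a left-invariant coupling actually sees — next brick.)
* THE SIGN-FLIP IDENTITY `classSum_eq` : for pure-top `g`,
  `Σ_{b ∈ cls a π} g b = (−1)^{#free} · Σ_{ρ ∈ ext π} g (a ∘ ρ)`, where `ext π` is the set of
  permutations of `Fin d` extending the partial map `π` — proved by flipping the free ("avoid the range
  of `a`") coordinates one at a time into "inside the range of `a`" coordinates, each flip costing a sign
  because the unconstrained line sum vanishes (`sum_eq_zero_of_saturated`). This is the tuple form of
  the paper's signed-octahedron computation behind Lemma 1.2 and of the two Cauchy–Schwarz steps of §2.7,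
  here an IDENTITY.
* THE `L²` BOUND `sum_sq_classSum_le` : `Σ_a (Σ_{b ∈ cls a π} g b)² ≤ (#ext π)² · Σ_b (g b)²`
  (Cauchy–Schwarz over `ext π` and the measure-preserving reindexing `a ↦ a ∘ ρ`).
* KNESER COROLLARY (= KL **Lemma 1.3**, all coordinates free, `ext = S_d`):
  `sum_sq_disjointSum_le` : `Σ_a (Σ_{b : range b ∩ range a = ∅} g b)² ≤ (d!)² Σ_b (g b)²`, i.e. for the
  disjointness (random-walk) operator `𝒟 g (a) = E_{b disjoint from a} g b` on `[n]_d`,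
  `‖𝒟 g‖₂ ≤ (d!/(n−d)_d) ‖g‖₂ = ‖g‖₂ / C(n−d, d)` (`disjointAvg_norm_sq_le`), which is `≤ (2d/n)^d ‖g‖₂`
  for `n ≥ 2d` as printed.

DEVIATION FROM PRINT (declared): the paper proves Lemma 1.3 through Lovász's Kneser spectrum (Lemma 1.2),
the identification `L²(C([n],k)) = M^{(n−k,k)}` and Young's rule (Lemma 1.1: "`α` is `0` or
`(−1)^k C(n−k,k)⁻¹`"); here the norm bound is obtained directly on tuples by inclusion–exclusion over the
free coordinates (no representation theory, no passage to `k`-sets), with the same constant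
`C(n−d,d)⁻¹`; and the general pattern classes (not in print) are what the next brick uses in place of
the staying decomposition (Lemmas 2.13–2.15). Counting (un-normalised) sums are used throughout; the
paper's expectation norms on `[n]_d` differ by the constant factor `|[n]_d|` on both sides of every
inequality here.

NOT here: couplings, spreadness, Lemma 2.11, the coupling `C` of §2.1, anything on `S_n` or `[n]^n`.
No facts, no instances, no notation; standard axioms. WHAT THIS IS NOT: not a proof of Theorem 1.8/3.1;
nothing about matchings or psd rank; no P-vs-NP content.
-/

noncomputable section

namespace Literature.Combinatorics.Additive.KeevashLifshitz

namespace Tuple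

open Finset

variable {α : Type*} [Fintype α] [DecidableEq α] {d : ℕ}

/-! ## Lines and pure top degree -/

/-- The **line** through the tuple `a` in coordinate `i`: all injective tuples agreeing with `a` at every
coordinate `j ≠ i`. [cite: KeevashLifshitz2023, §1.2 (juntas on `[n]_d`) and Lemma 2.16] -/
def line (i : Fin d) (a : Fin d ↪ α) : Finset (Fin d ↪ α) :=
  univ.filter fun b => ∀ j, j ≠ i → b j = a j

/-- [cite: KeevashLifshitz2023, §1.2] -/
theorem mem_line {i : Fin d} {a b : Fin d ↪ α} : b ∈ line i a ↔ ∀ j, j ≠ i → b j = a j := by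
  simp [line]

/-- [cite: KeevashLifshitz2023, §1.2] -/
theorem self_mem_line (i : Fin d) (a : Fin d ↪ α) : a ∈ line i a :=
  mem_line.2 fun _ _ => rfl

/-- Lines in a fixed coordinate are the classes of an equivalence relation.
[cite: KeevashLifshitz2023, §1.2] -/
theorem line_eq_line_of_mem {i : Fin d} {a b : Fin d ↪ α} (h : b ∈ line i a) : line i b = line i a := by
  ext c
  rw [mem_line, mem_line]
  rw [mem_line] at h
  constructor
  · intro hc j hj; rw [hc j hj, h j hj]
  · intro hc j hj; rw [hc j hj, h j hj]

/-- **Pure top degree** on `d`-tuples (the paper's `V_{=d}(L²([n]_d))`: orthogonal to every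
`(d−1)`-junta): every line sum of `g` vanishes. [cite: KeevashLifshitz2023, §1.2 and Lemma 2.16] -/
def IsPureTop (g : (Fin d ↪ α) → ℝ) : Prop :=
  ∀ (i : Fin d) (a : Fin d ↪ α), ∑ b ∈ line i a, g b = 0

/-- A set of tuples is **saturated** in coordinate `i` if it is a union of `i`-lines.
[cite: KeevashLifshitz2023, §1.2] -/
def IsSaturated (i : Fin d) (S : Finset (Fin d ↪ α)) : Prop :=
  ∀ b ∈ S, ∀ c ∈ line i b, c ∈ S

/-- The sum of a pure-top function over a set saturated in some coordinate vanishes (the set is a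
disjoint union of lines). [cite: KeevashLifshitz2023, §1.2 and Lemma 2.16 (proof)] -/
theorem sum_eq_zero_of_saturated {g : (Fin d ↪ α) → ℝ} (hg : IsPureTop g) {i : Fin d}
    {S : Finset (Fin d ↪ α)} (hS : IsSaturated i S) : ∑ b ∈ S, g b = 0 := by
  classical
  -- key: the restriction of a tuple to the coordinates `≠ i`
  let key : (Fin d ↪ α) → ({j : Fin d // j ≠ i} → α) := fun b j => b j.1
  have hkey : ∀ b c : Fin d ↪ α, key c = key b ↔ c ∈ line i b := by
    intro b c
    rw [mem_line]
    constructor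
    · intro h j hj
      exact congr_fun h ⟨j, hj⟩
    · intro h
      funext j
      exact h j.1 j.2
  rw [← sum_fiberwise_of_maps_to (g := key) (t := S.image key) (fun b hb => mem_image_of_mem key hb)]
  refine sum_eq_zero fun k hk => ?_
  obtain ⟨b₀, hb₀, rfl⟩ := mem_image.1 hk
  have hfib : S.filter (fun c => key c = key b₀) = line i b₀ := by
    ext c
    rw [mem_filter, hkey]
    constructor
    · exact fun h => h.2
    · exact fun h => ⟨hS b₀ hb₀ c h, h⟩
  rw [hfib]
  exact hg i b₀

/-- A function `h` on tuples **does not depend on coordinate `i`** (is a junta on the other `d − 1`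
coordinates). [cite: KeevashLifshitz2023, §1.2] -/
def IndepOf (i : Fin d) (h : (Fin d ↪ α) → ℝ) : Prop :=
  ∀ a b : Fin d ↪ α, b ∈ line i a → h b = h a

/-- **`V_{=d}` = orthogonal complement of the `(d−1)`-juntas**: all line sums of `g` vanish iff `g` is
orthogonal (for the counting inner product) to every function not depending on some coordinate.
[cite: KeevashLifshitz2023, §1.2 ("`V_{=d}(M)` … the orthogonal complement of `V_{≤ d−1}(M)`")] -/
theorem isPureTop_iff_orthogonal_juntas (g : (Fin d ↪ α) → ℝ) :
    IsPureTop g ↔ ∀ (i : Fin d) (h : (Fin d ↪ α) → ℝ), IndepOf i h → ∑ b, g b * h b = 0 := by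
  classical
  constructor
  · intro hg i h hh
    -- group the sum by lines: on each line `h` is constant and the `g`-sum vanishes
    let key : (Fin d ↪ α) → ({j : Fin d // j ≠ i} → α) := fun b j => b j.1
    have hkey : ∀ b c : Fin d ↪ α, key c = key b ↔ c ∈ line i b := by
      intro b c
      rw [mem_line]
      constructor
      · intro e j hj
        exact congr_fun e ⟨j, hj⟩
      · intro e
        funext j
        exact e j.1 j.2
    rw [← sum_fiberwise_of_maps_to (g := key) (t := univ.image key) (s := univ)
      (fun b _ => mem_image_of_mem key (mem_univ b))]
    refine sum_eq_zero fun k hk => ?_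
    obtain ⟨b₀, -, rfl⟩ := mem_image.1 hk
    have hfib : (univ : Finset (Fin d ↪ α)).filter (fun c => key c = key b₀) = line i b₀ := by
      ext c
      rw [mem_filter, hkey]
      simp
    rw [hfib]
    calc ∑ c ∈ line i b₀, g c * h c = ∑ c ∈ line i b₀, g c * h b₀ :=
          sum_congr rfl fun c hc => by rw [hh b₀ c hc]
      _ = (∑ c ∈ line i b₀, g c) * h b₀ := by rw [sum_mul]
      _ = 0 := by rw [hg i b₀, zero_mul]
  · intro H i a
    -- test against the indicator of the line, which does not depend on coordinate `i`
    have hind : IndepOf i (fun b => if b ∈ line i a then (1 : ℝ) else 0) := by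
      intro b c hc
      by_cases hb : b ∈ line i a
      · have : c ∈ line i a := by rw [← line_eq_line_of_mem hb]; exact hc
        simp [hb, this]
      · have : c ∉ line i a := by
          intro hc'
          apply hb
          have e1 : line i c = line i a := line_eq_line_of_mem hc'
          have e2 : line i c = line i b := line_eq_line_of_mem hc
          rw [← e1, e2]
          exact self_mem_line i b
        simp [hb, this]
    have := H i _ hind
    simpa [mul_ite, sum_ite_mem, univ_inter, Finset.filter_mem_eq_inter] using this

/-- Restrictions preserve pure top degree (KL **Lemma 2.16**, in line-sum form it is a tautology: a line
of the restricted function is a line of the function). Stated as: the sum of a pure-top `g` over the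
tuples with prescribed values on a set of coordinates and one further FREE coordinate vanishes — the
special case of `sum_eq_zero_of_saturated` used below. [cite: KeevashLifshitz2023, Lemma 2.16] -/
theorem sum_filter_eq_zero_of_free {g : (Fin d ↪ α) → ℝ} (hg : IsPureTop g) (i : Fin d)
    (P : (Fin d ↪ α) → Prop) [DecidablePred P]
    (hP : ∀ b c : Fin d ↪ α, c ∈ line i b → (P b ↔ P c)) :
    ∑ b ∈ univ.filter P, g b = 0 := by
  refine sum_eq_zero_of_saturated hg (i := i) ?_
  intro b hb c hc
  rw [mem_filter] at hb ⊢
  exact ⟨mem_univ _, (hP b c hc).1 hb.2⟩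

/-! ## Patterns and pattern classes -/

/-- The **pattern** of `b` relative to `a`: `pat a b i = some j` if `b i = a j`, and `none` if `b i` is
not a value of `a`. (Refines the paper's `stay(a,b) = {i : b_i ∈ {a_1,…,a_d}}`, Def. 2.12.)
[cite: KeevashLifshitz2023, Def. 2.12] -/
def pat (a b : Fin d ↪ α) : Fin d → Option (Fin d) :=
  fun i => if h : ∃ j, a j = b i then some h.choose else none

omit [Fintype α] in
/-- [cite: KeevashLifshitz2023, Def. 2.12] -/
theorem pat_eq_some_iff {a b : Fin d ↪ α} {i j : Fin d} : pat a b i = some j ↔ a j = b i := by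
  unfold pat
  split_ifs with h
  · constructor
    · intro e
      have := h.choose_spec
      rw [Option.some.injEq] at e
      rwa [e] at this
    · intro e
      have := h.choose_spec
      rw [Option.some.injEq]
      exact a.injective (this.trans e.symm)
  · simp only [false_iff]
    exact fun e => h ⟨j, e⟩

omit [Fintype α] in
/-- [cite: KeevashLifshitz2023, Def. 2.12] -/
theorem pat_eq_none_iff {a b : Fin d ↪ α} {i : Fin d} : pat a b i = none ↔ ∀ j, a j ≠ b i := by
  unfold pat
  split_ifs with h
  · simp only [false_iff, not_forall, not_not]; exact h
  · simp only [true_iff]; exact fun j e => h ⟨j, e⟩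

omit [Fintype α] in
/-- The pattern of `a` relative to itself is the identity. [cite: KeevashLifshitz2023, Def. 2.12] -/
theorem pat_self (a : Fin d ↪ α) : pat a a = fun i => some i :=
  funext fun _ => pat_eq_some_iff.2 rfl

/-- The **pattern class** of `π` at `a`: all tuples whose pattern relative to `a` is `π`.
[cite: KeevashLifshitz2023, Def. 2.12 and Lemma 2.13] -/
def cls (a : Fin d ↪ α) (π : Fin d → Option (Fin d)) : Finset (Fin d ↪ α) :=
  univ.filter fun b => pat a b = π

/-- [cite: KeevashLifshitz2023, Def. 2.12] -/
theorem mem_cls {a b : Fin d ↪ α} {π : Fin d → Option (Fin d)} : b ∈ cls a π ↔ pat a b = π := by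
  simp [cls]

/-- The pattern classes at `a` partition the tuples: a sum over all tuples is the sum over patterns of
the class sums (the paper's "staying decomposition", Lemma 2.13, refined to patterns).
[cite: KeevashLifshitz2023, Lemma 2.13] -/
theorem sum_cls_sum (a : Fin d ↪ α) (F : (Fin d ↪ α) → ℝ) :
    ∑ π : Fin d → Option (Fin d), ∑ b ∈ cls a π, F b = ∑ b, F b := by
  classical
  have := sum_fiberwise (s := (univ : Finset (Fin d ↪ α))) (g := fun b => pat a b) (f := F)
  simpa [cls] using this

/-- The class of the identity pattern is `{a}` (the "lazy" part of a coupling).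
[cite: KeevashLifshitz2023, §2.4 (`p_lazy = ν({a = b})`)] -/
theorem cls_id (a : Fin d ↪ α) : cls a (fun i => some i) = {a} := by
  ext b
  rw [mem_cls, mem_singleton]
  constructor
  · intro h
    ext i
    have := congr_fun h i
    rw [pat_eq_some_iff] at this
    exact this.symm
  · rintro rfl; exact pat_self _

/-! ## The sign-flip identity -/

/-- Generalised classes used in the induction: coordinates with `π i = some j` are pinned to `a j`; free
coordinates (`π i = none`) in `A` must AVOID the range of `a`, those in `I` must lie INSIDE it, the others
are unconstrained. [cite: KeevashLifshitz2023, §2.7 (proof of Lemma 2.15)] -/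
def gcls (a : Fin d ↪ α) (π : Fin d → Option (Fin d)) (A I : Finset (Fin d)) : Finset (Fin d ↪ α) :=
  univ.filter fun b => ∀ i,
    (∀ j, π i = some j → b i = a j) ∧
    (π i = none → i ∈ A → ∀ j, a j ≠ b i) ∧
    (π i = none → i ∈ I → ∃ j, a j = b i)

/-- [cite: KeevashLifshitz2023, §2.7] -/
theorem mem_gcls {a b : Fin d ↪ α} {π : Fin d → Option (Fin d)} {A I : Finset (Fin d)} :
    b ∈ gcls a π A I ↔ ∀ i,
      (∀ j, π i = some j → b i = a j) ∧
      (π i = none → i ∈ A → ∀ j, a j ≠ b i) ∧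
      (π i = none → i ∈ I → ∃ j, a j = b i) := by
  simp only [gcls, mem_filter, mem_univ, true_and]

/-- The set of free coordinates of a pattern. [cite: KeevashLifshitz2023, Def. 2.12 (complement of `stay`)] -/
def freeSet (π : Fin d → Option (Fin d)) : Finset (Fin d) := univ.filter fun i => π i = none

/-- [cite: KeevashLifshitz2023, Def. 2.12] -/
theorem mem_freeSet {π : Fin d → Option (Fin d)} {i : Fin d} : i ∈ freeSet π ↔ π i = none := by
  simp [freeSet]

/-- The pattern class is the generalised class "all free coordinates avoid".
[cite: KeevashLifshitz2023, Def. 2.12] -/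
theorem cls_eq_gcls (a : Fin d ↪ α) (π : Fin d → Option (Fin d)) :
    cls a π = gcls a π (freeSet π) ∅ := by
  ext b
  rw [mem_cls, mem_gcls]
  constructor
  · intro h i
    refine ⟨fun j hj => ?_, fun hi _ j => ?_, fun _ hi => ?_⟩
    · rw [← h] at hj; exact (pat_eq_some_iff.1 hj).symm
    · rw [← h] at hi; exact pat_eq_none_iff.1 hi j
    · simp at hi
  · intro h
    funext i
    obtain ⟨h1, h2, -⟩ := h i
    cases hπ : π i with
    | none => exact pat_eq_none_iff.2 (h2 hπ (mem_freeSet.2 hπ))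
    | some j => exact pat_eq_some_iff.2 (h1 j hπ).symm

/-- Flipping one free coordinate: "avoid" = "unconstrained" minus "inside".
[cite: KeevashLifshitz2023, §2.7 (proof of Lemma 2.15)] -/
theorem gcls_avoid_eq_sdiff (a : Fin d ↪ α) (π : Fin d → Option (Fin d)) {A I : Finset (Fin d)}
    {i₀ : Fin d} (hπ : π i₀ = none) (hI : i₀ ∉ I) :
    gcls a π (insert i₀ A) I = gcls a π A I \ gcls a π A (insert i₀ I) := by
  ext b
  simp only [mem_sdiff, mem_gcls]
  constructor
  · intro h
    refine ⟨fun i => ?_, fun h' => ?_⟩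
    · obtain ⟨h1, h2, h3⟩ := h i
      exact ⟨h1, fun hπ' hi => h2 hπ' (mem_insert_of_mem hi), h3⟩
    · obtain ⟨-, h2, -⟩ := h i₀
      obtain ⟨-, -, h3'⟩ := h' i₀
      obtain ⟨j, hj⟩ := h3' hπ (mem_insert_self _ _)
      exact h2 hπ (mem_insert_self _ _) j hj
  · rintro ⟨h, h'⟩ i
    obtain ⟨h1, h2, h3⟩ := h i
    refine ⟨h1, fun hπ' hi j hj => ?_, h3⟩
    rcases mem_insert.1 hi with rfl | hi
    · -- `i = i₀`: if `b i₀` were inside the range, `b` would lie in the subtracted set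
      apply h'
      intro i'
      obtain ⟨k1, k2, k3⟩ := h i'
      refine ⟨k1, k2, fun hπ'' hi' => ?_⟩
      rcases mem_insert.1 hi' with rfl | hi'
      · exact ⟨j, hj⟩
      · exact k3 hπ'' hi'
    · exact h2 hπ' hi j hj

/-- [cite: KeevashLifshitz2023, §2.7] -/
theorem gcls_insert_subset (a : Fin d ↪ α) (π : Fin d → Option (Fin d)) (A I : Finset (Fin d))
    (i₀ : Fin d) : gcls a π A (insert i₀ I) ⊆ gcls a π A I := by
  intro b hb
  rw [mem_gcls] at hb ⊢
  intro i
  obtain ⟨h1, h2, h3⟩ := hb i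
  exact ⟨h1, h2, fun hπ hi => h3 hπ (mem_insert_of_mem hi)⟩

/-- A generalised class with an unconstrained free coordinate has zero `g`-sum for pure-top `g`.
[cite: KeevashLifshitz2023, Lemma 2.16 and §2.7] -/
theorem sum_gcls_eq_zero_of_free {g : (Fin d ↪ α) → ℝ} (hg : IsPureTop g) (a : Fin d ↪ α)
    (π : Fin d → Option (Fin d)) {A I : Finset (Fin d)} {i₀ : Fin d} (hπ : π i₀ = none)
    (hA : i₀ ∉ A) (hI : i₀ ∉ I) : ∑ b ∈ gcls a π A I, g b = 0 := by
  refine sum_eq_zero_of_saturated hg (i := i₀) ?_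
  intro b hb c hc
  rw [mem_gcls] at hb ⊢
  rw [mem_line] at hc
  intro i
  by_cases hi : i = i₀
  · subst hi
    refine ⟨fun j hj => ?_, fun _ h => (hA h).elim, fun _ h => (hI h).elim⟩
    rw [hπ] at hj; cases hj
  · obtain ⟨h1, h2, h3⟩ := hb i
    rw [hc i hi]
    exact ⟨h1, h2, h3⟩

/-- **Sign-flip**: moving the avoid-coordinates into inside-coordinates costs `(−1)^{#A}`.
[cite: KeevashLifshitz2023, §2.7 (proof of Lemma 2.15) and Lemma 1.2 (signed octahedra)] -/
theorem sum_gcls_eq_neg_pow (g : (Fin d ↪ α) → ℝ) (hg : IsPureTop g) (a : Fin d ↪ α)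
    (π : Fin d → Option (Fin d)) (A : Finset (Fin d)) :
    ∀ I : Finset (Fin d), Disjoint A I → (∀ i ∈ A, π i = none) →
      ∑ b ∈ gcls a π A I, g b = (-1) ^ A.card * ∑ b ∈ gcls a π ∅ (A ∪ I), g b := by
  classical
  induction A using Finset.induction_on with
  | empty => intro I _ _; simp
  | @insert i₀ A hi₀ ih =>
    intro I hdis hnone
    have hI : i₀ ∉ I := by
      intro h
      exact (disjoint_left.1 hdis (mem_insert_self i₀ A)) h
    have hπ : π i₀ = none := hnone i₀ (mem_insert_self _ _)
    rw [gcls_avoid_eq_sdiff a π hπ hI, sum_sdiff_eq_sub (gcls_insert_subset a π A I i₀),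
      sum_gcls_eq_zero_of_free hg a π hπ hi₀ hI, zero_sub]
    have hdis' : Disjoint A (insert i₀ I) := by
      rw [disjoint_insert_right]
      exact ⟨hi₀, (disjoint_insert_left.1 hdis).2⟩
    rw [ih (insert i₀ I) hdis' fun i hi => hnone i (mem_insert_of_mem hi), card_insert_of_notMem hi₀,
      pow_succ]
    have : A ∪ insert i₀ I = insert i₀ A ∪ I := by
      ext x; simp
    rw [this]
    ring

/-! ## The final class: permutations extending the pattern -/

/-- The permutations of the coordinates EXTENDING the partial map `π` (`ρ i = j` whenever
`π i = some j`). [cite: KeevashLifshitz2023, §2.7] -/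
def ext (π : Fin d → Option (Fin d)) : Finset (Equiv.Perm (Fin d)) :=
  univ.filter fun ρ => ∀ i j, π i = some j → ρ i = j

/-- [cite: KeevashLifshitz2023, §2.7] -/
theorem mem_ext {π : Fin d → Option (Fin d)} {ρ : Equiv.Perm (Fin d)} :
    ρ ∈ ext π ↔ ∀ i j, π i = some j → ρ i = j := by
  simp [ext]

/-- Reindexing a tuple by a permutation of the coordinates: `(a ∘ ρ) i = a (ρ i)`.
[cite: KeevashLifshitz2023, §1.1 (the right action `R_σ`)] -/
def compPerm (ρ : Equiv.Perm (Fin d)) : (Fin d ↪ α) ≃ (Fin d ↪ α) where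
  toFun a := ρ.toEmbedding.trans a
  invFun a := ρ.symm.toEmbedding.trans a
  left_inv a := by ext i; simp
  right_inv a := by ext i; simp

omit [Fintype α] [DecidableEq α] in
/-- [cite: KeevashLifshitz2023, §1.1] -/
@[simp] theorem compPerm_apply (ρ : Equiv.Perm (Fin d)) (a : Fin d ↪ α) (i : Fin d) :
    compPerm ρ a i = a (ρ i) := rfl

/-- The generalised class "pinned by `π`, all free coordinates INSIDE the range of `a`" is the image of
`ext π` under `ρ ↦ a ∘ ρ`. [cite: KeevashLifshitz2023, §2.7] -/
theorem sum_gcls_inside_eq_sum_ext (F : (Fin d ↪ α) → ℝ) (a : Fin d ↪ α) (π : Fin d → Option (Fin d))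
    {N : Finset (Fin d)} (hN : ∀ i, π i = none → i ∈ N) :
    ∑ b ∈ gcls a π ∅ N, F b = ∑ ρ ∈ ext π, F (compPerm ρ a) := by
  classical
  symm
  refine sum_bij (fun ρ _ => compPerm ρ a) (fun ρ hρ => ?_) (fun ρ₁ h₁ ρ₂ h₂ e => ?_)
    (fun b hb => ?_) (fun _ _ => rfl)
  · -- lands in the class
    rw [mem_ext] at hρ
    rw [mem_gcls]
    intro i
    refine ⟨fun j hj => ?_, fun _ h => by simp at h, fun _ _ => ⟨ρ i, rfl⟩⟩
    show a (ρ i) = a j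
    rw [hρ i j hj]
  · -- injective
    ext i
    have := congr_arg (fun b : Fin d ↪ α => b i) e
    simp only [compPerm_apply] at this
    exact congr_arg Fin.val (a.injective this)
  · -- surjective: every coordinate of `b` is a value of `a`
    rw [mem_gcls] at hb
    have hin : ∀ i, ∃ j, a j = b i := by
      intro i
      obtain ⟨h1, -, h3⟩ := hb i
      cases hπ : π i with
      | none => exact h3 hπ (hN i hπ)
      | some j => exact ⟨j, (h1 j hπ).symm⟩
    choose f hf using hin
    have hfinj : Function.Injective f := by
      intro i j e
      apply b.injective
      rw [← hf i, ← hf j, e]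
    have hfbij : Function.Bijective f := Finite.injective_iff_bijective.1 hfinj
    refine ⟨Equiv.ofBijective f hfbij, ?_, ?_⟩
    · rw [mem_ext]
      intro i j hj
      obtain ⟨h1, -, -⟩ := hb i
      have := h1 j hj
      show f i = j
      apply a.injective
      rw [hf i, this]
    · ext i
      simp [hf i]

/-- **The class-sum identity**: for pure-top `g`,
`Σ_{b ∈ cls a π} g b = (−1)^{#free(π)} Σ_{ρ ∈ ext π} g (a ∘ ρ)`.
[cite: KeevashLifshitz2023, Lemma 1.2/1.3 and §2.7 (proof of Lemma 2.15)] -/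
theorem classSum_eq {g : (Fin d ↪ α) → ℝ} (hg : IsPureTop g) (a : Fin d ↪ α)
    (π : Fin d → Option (Fin d)) :
    ∑ b ∈ cls a π, g b = (-1) ^ (freeSet π).card * ∑ ρ ∈ ext π, g (compPerm ρ a) := by
  classical
  rw [cls_eq_gcls, sum_gcls_eq_neg_pow g hg a π (freeSet π) ∅ (disjoint_empty_right _)
    (fun i hi => mem_freeSet.1 hi), union_empty,
    sum_gcls_inside_eq_sum_ext g a π (fun i hi => mem_freeSet.2 hi)]

/-! ## The `L²` bound -/

omit [DecidableEq α] in
/-- Reindexing by a permutation of the coordinates preserves counting sums over all tuples.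
[cite: KeevashLifshitz2023, §1.1 (invariance of the uniform measure under `R_σ`)] -/
theorem sum_compPerm (ρ : Equiv.Perm (Fin d)) (F : (Fin d ↪ α) → ℝ) :
    ∑ a, F (compPerm ρ a) = ∑ a, F a :=
  Equiv.sum_comp (compPerm ρ) F

/-- **`L²` bound for class sums**: `Σ_a (Σ_{b ∈ cls a π} g b)² ≤ (#ext π)² · Σ_b (g b)²` for pure-top
`g`. (Cauchy–Schwarz over `ext π` after `classSum_eq`, then the measure-preserving reindexing
`a ↦ a ∘ ρ`.) [cite: KeevashLifshitz2023, Lemma 2.15 (our pattern form)] -/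
theorem sum_sq_classSum_le {g : (Fin d ↪ α) → ℝ} (hg : IsPureTop g) (π : Fin d → Option (Fin d)) :
    ∑ a, (∑ b ∈ cls a π, g b) ^ 2 ≤ ((ext π).card : ℝ) ^ 2 * ∑ b, g b ^ 2 := by
  classical
  calc ∑ a, (∑ b ∈ cls a π, g b) ^ 2
      = ∑ a : Fin d ↪ α, (∑ ρ ∈ ext π, g (compPerm ρ a)) ^ 2 := by
        refine sum_congr rfl fun a _ => ?_
        rw [classSum_eq hg a π, mul_pow, ← pow_mul, ((even_two).mul_left _).neg_one_pow, one_mul]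
    _ ≤ ∑ a : Fin d ↪ α, ((ext π).card : ℝ) * ∑ ρ ∈ ext π, g (compPerm ρ a) ^ 2 :=
        sum_le_sum fun a _ => sq_sum_le_card_mul_sum_sq
    _ = ((ext π).card : ℝ) * ∑ ρ ∈ ext π, ∑ a : Fin d ↪ α, g (compPerm ρ a) ^ 2 := by
        rw [← mul_sum, sum_comm]
    _ = ((ext π).card : ℝ) * ∑ ρ ∈ ext π, ∑ a : Fin d ↪ α, g a ^ 2 := by
        congr 1
        exact sum_congr rfl fun ρ _ => sum_compPerm ρ (fun a => g a ^ 2)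
    _ = ((ext π).card : ℝ) ^ 2 * ∑ b, g b ^ 2 := by
        rw [sum_const, nsmul_eq_mul, sq, mul_assoc]

/-! ## The Kneser corollary (KL Lemma 1.3) -/

/-- The all-free pattern. [cite: KeevashLifshitz2023, §1.3] -/
def freePat (d : ℕ) : Fin d → Option (Fin d) := fun _ => none

/-- The class of the all-free pattern at `a` is the set of tuples DISJOINT from `a` (no common value) —
the neighbourhood of `a` in the disjointness graph `D_{n,d}`. [cite: KeevashLifshitz2023, §1.3 (`D_{n,k}`)] -/
theorem mem_cls_freePat {a b : Fin d ↪ α} : b ∈ cls a (freePat d) ↔ ∀ i j, a j ≠ b i := by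
  rw [mem_cls]
  constructor
  · intro h i j
    have := congr_fun h i
    exact pat_eq_none_iff.1 this j
  · intro h
    funext i
    exact pat_eq_none_iff.2 (h i)

/-- Every permutation extends the all-free pattern: `ext (freePat d) = S_d`.
[cite: KeevashLifshitz2023, §1.3] -/
theorem ext_freePat : ext (freePat d) = (univ : Finset (Equiv.Perm (Fin d))) := by
  ext ρ; simp [mem_ext, freePat]

/-- **KL Lemma 1.3 (counting form).** For `g` of pure top degree on `d`-tuples,
`Σ_a (Σ_{b disjoint from a} g b)² ≤ (d!)² Σ_b (g b)²`. [cite: KeevashLifshitz2023, Lemma 1.3] -/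
theorem sum_sq_disjointSum_le {g : (Fin d ↪ α) → ℝ} (hg : IsPureTop g) :
    ∑ a, (∑ b ∈ cls a (freePat d), g b) ^ 2 ≤ (d.factorial : ℝ) ^ 2 * ∑ b, g b ^ 2 := by
  have h := sum_sq_classSum_le hg (freePat d)
  rwa [ext_freePat, card_univ, Fintype.card_perm, Fintype.card_fin] at h

/-- The number of tuples disjoint from a given `d`-tuple is the falling factorial `(n − d)_d`,
`n = |α|`. [cite: KeevashLifshitz2023, §1.3 ("every vertex in `K_{n,k}` has degree `C(n−k,k)`")] -/
theorem card_cls_freePat (a : Fin d ↪ α) :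
    (cls a (freePat d)).card = (Fintype.card α - d).descFactorial d := by
  classical
  -- tuples disjoint from `a` = embeddings of `Fin d` into the complement of the range of `a`
  let T : Type _ := {x : α // x ∉ Set.range a}
  have hT : Fintype.card T = Fintype.card α - d := by
    rw [Fintype.card_subtype_compl, Set.card_range_of_injective a.injective, Fintype.card_fin]
  have key : (cls a (freePat d)).card = Fintype.card (Fin d ↪ T) := by
    rw [← Fintype.card_coe]
    refine Fintype.card_congr ?_
    exact
      { toFun := fun b => ⟨fun i => ⟨b.1 i, fun ⟨j, hj⟩ => (mem_cls_freePat.1 b.2) i j hj⟩,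
          fun i j e => b.1.injective (congr_arg Subtype.val e)⟩
        invFun := fun c => ⟨⟨fun i => (c i).1, fun i j e => c.injective (Subtype.ext e)⟩,
          mem_cls_freePat.2 fun i j hj => (c i).2 ⟨j, hj⟩⟩
        left_inv := fun b => by ext i; rfl
        right_inv := fun c => by ext i; rfl }
  rw [key, Fintype.card_embedding_eq, Fintype.card_fin, hT]

/-- **KL Lemma 1.3 (normalised form).** With `𝒟 g (a) := (Σ_{b disjoint from a} g b)/(n−d)_d` the
disjointness-walk operator on `d`-tuples of an `n`-set (`n ≥ 2d`, so that `(n−d)_d > 0`), for `g` of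
pure top degree `Σ_a (𝒟 g a)² ≤ (d!/(n−d)_d)² Σ_a (g a)²`, i.e. `‖𝒟 g‖₂ ≤ ‖g‖₂ / C(n−d,d)`
(`(n−d)_d = C(n−d,d)·d!`); the paper states the weaker `≤ (2d/n)^d ‖g‖₂`.
[cite: KeevashLifshitz2023, Lemma 1.3] -/
theorem disjointAvg_norm_sq_le {g : (Fin d ↪ α) → ℝ} (hg : IsPureTop g)
    (hn : 2 * d ≤ Fintype.card α) :
    ∑ a, ((∑ b ∈ cls a (freePat d), g b) / ((Fintype.card α - d).descFactorial d : ℝ)) ^ 2 ≤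
      ((d.factorial : ℝ) / ((Fintype.card α - d).descFactorial d : ℝ)) ^ 2 * ∑ b, g b ^ 2 := by
  have hpos : (0 : ℝ) < ((Fintype.card α - d).descFactorial d : ℝ) := by
    have : 0 < (Fintype.card α - d).descFactorial d := Nat.descFactorial_pos.2 (by omega)
    exact_mod_cast this
  have h := sum_sq_disjointSum_le hg
  calc ∑ a, ((∑ b ∈ cls a (freePat d), g b) / ((Fintype.card α - d).descFactorial d : ℝ)) ^ 2
      = (∑ a, (∑ b ∈ cls a (freePat d), g b) ^ 2) / ((Fintype.card α - d).descFactorial d : ℝ) ^ 2 := by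
        rw [sum_div]
        exact sum_congr rfl fun a _ => by rw [div_pow]
    _ ≤ ((d.factorial : ℝ) ^ 2 * ∑ b, g b ^ 2) / ((Fintype.card α - d).descFactorial d : ℝ) ^ 2 :=
        div_le_div_of_nonneg_right h (by positivity)
    _ = ((d.factorial : ℝ) / ((Fintype.card α - d).descFactorial d : ℝ)) ^ 2 * ∑ b, g b ^ 2 := by
        rw [div_pow]; ring

end Tuple

end Literature.Combinatorics.Additive.KeevashLifshitz

end
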